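import Mathlib.RingTheory.NoetherNormalization
import Mathlib.RingTheory.KrullDimension.Polynomial
import Mathlib.RingTheory.KrullDimension.Field
import Mathlib.RingTheory.TensorProduct.MvPolynomial
import Mathlib.RingTheory.TensorProduct.Quotient
import Mathlib.RingTheory.Flat.Stability
import Mathlib.RingTheory.Flat.TorsionFree
import Mathlib.RingTheory.Ideal.MinimalPrime.Localization
import Mathlib.RingTheory.Ideal.Height
import Mathlib.RingTheory.Localization.AtPrime.Basic
import Mathlib.RingTheory.Artinian.Ring
import Mathlib.LinearAlgebra.LinearIndependent.Lemmas
import Mathlib.LinearAlgebra.Basis.Basic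
import Literature.RingTheory.KrullDimension.AffineDimension
import HarnessLib

/-!
# Dimension of the irreducible components of a base change `A ⊗ₖ L`

For an affine domain `A` over a field `k` (finitely generated, integral) and an arbitrary field
extension `L` of `k`, **every irreducible component of `Spec (A ⊗ₖ L)` has dimension `dim A`**:
for every minimal prime `Q` of `A ⊗ₖ L`, `dim (A ⊗ₖ L) ⧸ Q = dim A`
(`Literature.RingTheory.KrullDimension.ringKrullDim_quotient_tensorProduct_of_mem_minimalPrimes`; Görtz–Wedhorn I, Prop. 5.38
"`dim X = dim X ⊗ₖ K`" and Exercise 5.12 "`dim Z' = dim Z`" for the components; Fulton,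
*Intersection Theory*, Example 6.2.9: `[V] ↦ [V_L]` is a homomorphism `Z_k X → Z_k X_L`, i.e.
`V_L` is purely `k`-dimensional). This is the commutative algebra behind the fact that flat
pull-back of cycles along `X_L → X` preserves the dimension grading
(`Literature.AlgebraicGeometry.Motives.SubschemeCycles`, `Literature.AlgebraicGeometry.Motives.AlgebraicCycle.baseChange_mem_cyclesOfDim`).

## Proof

We follow the proof of Görtz–Wedhorn I, Prop. 5.38, refined to single components. By Noether
normalization there is a finite injective `T = k[t₁,…,tₛ] → A`, `s = dim A`; base change gives a
finite injective `T_L = L[t₁,…,tₛ] → T_L ⊗_T A ≅ A ⊗ₖ L`. The point is that a minimal prime `Q`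
of `T_L ⊗_T A` contracts to `(0)` in `T_L`: then `(T_L ⊗_T A) ⧸ Q` is a domain, integral over
`T_L` with `T_L` embedded, so it has dimension `dim T_L = s`. For the contraction: `A` is a
finite torsion-free `T`-module, hence embeds `T`-linearly into a free `T`-module `F`
(`Literature.RingTheory.KrullDimension.exists_injective_linearMap_of_isTorsionFree`: a maximal linearly independent subset spans
a free submodule `F`, and a common denominator `d ≠ 0` of the generators gives `a ↦ d • a : A ↪ F`);
by flatness of `T_L` over `T`, `T_L ⊗_T A ↪ T_L ⊗_T F`, a free `T_L`-module, so `T_L ⊗_T A` is a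
torsion-free `T_L`-module (`Literature.RingTheory.KrullDimension.isTorsionFree_tensorProduct`); and the elements of a minimal prime
are zero divisors (Mathlib `Ideal.exists_mul_mem_of_mem_minimalPrimes`), so a minimal prime of a
torsion-free algebra over a domain contracts to `(0)`
(`Literature.RingTheory.KrullDimension.comap_eq_bot_of_mem_minimalPrimes`).

## Main results

* `Literature.RingTheory.KrullDimension.ringKrullDim_quotient_tensorProduct_of_mem_minimalPrimes`: `dim (A ⊗ₖ L) ⧸ Q = dim A` for
  `Q` a minimal prime, `A` an affine domain over `k`.
* `Literature.RingTheory.KrullDimension.ringKrullDim_quotient_eq_of_isPushout_of_mem_minimalPrimes`: the relative form used for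
  schemes: for `R` of finite type over `k`, `R' = R ⊗ₖ L` (any `Algebra.IsPushout k R L R'`) and a
  prime `𝔮 ⊂ R'` minimal over `𝔭R'`, `𝔭 = 𝔮 ∩ R`: `dim R' ⧸ 𝔮 = dim R ⧸ 𝔭`.
* `Literature.RingTheory.KrullDimension.mem_minimalPrimes_map_of_isArtinianRing`: `𝔮` is minimal over `𝔭R'` as soon as the fibre
  ring `R'_𝔮 ⧸ 𝔭R'_𝔮` of the local homomorphism `R_𝔭 → R'_𝔮` is Artinian (the form in which the
  hypothesis arises from the multiplicity `ℓ(𝒪_{X_L, z} ⧸ 𝔪ₓ 𝒪_{X_L, z})` of a flat pull-back).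

## References

* U. Görtz, T. Wedhorn, *Algebraic Geometry I: Schemes*, 2nd ed. (2020), Prop. 5.38 (p. 165),
  Exercise 5.12 (p. 177), Cor. 5.45.
* W. Fulton, *Intersection Theory*, 2nd ed. (1998), Example 6.2.9.
* H. Matsumura, *Commutative Ring Theory* (1986), Thm. 5.6, Thm. 9.4.
-/

noncomputable section

open TensorProduct

namespace Literature.RingTheory.KrullDimension

universe u

/-! ### Finite torsion-free modules embed in free modules -/

section Embedding

variable {T : Type*} [CommRing T] [IsDomain T] {A : Type*} [AddCommGroup A] [Module T A]

/-- A finite torsion-free module `A` over a domain `T` embeds `T`-linearly into a free `T`-module: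
the span `F` of a maximal linearly independent subset `s ⊆ A` is free, every `a ∈ A` has a
non-zero multiple in `F` (maximality of `s`), and for a common multiplier `d ≠ 0` of a finite set
of generators, `a ↦ d • a` maps `A` injectively into `F` (standard; e.g. the first step in the
proof that finite torsion-free modules over a Dedekind domain are projective). [folklore] -/
theorem exists_injective_linearMap_of_isTorsionFree [Module.IsTorsionFree T A] [Module.Finite T A] :
    ∃ (F : Submodule T A), Module.Free T F ∧ ∃ f : A →ₗ[T] F, Function.Injective f := by
  classical
  obtain ⟨s, hli, hmax⟩ := exists_maximal_linearIndepOn T (id : A → A)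
  let F : Submodule T A := Submodule.span T s
  have hF : Module.Free T F := by
    have hli' : LinearIndependent T (fun x : s ↦ (x : A)) := hli
    let b := Module.Basis.span hli'
    have hrange : Submodule.span T (Set.range fun x : s ↦ (x : A)) = F := by
      rw [Subtype.range_coe]
    exact Module.Free.of_basis (b.map (LinearEquiv.ofEq _ _ hrange))
  -- a nonzero `c a` with `c a • a ∈ F`, for every `a`
  have hc : ∀ a : A, ∃ c : T, c ≠ 0 ∧ c • a ∈ F := by
    intro a
    by_cases ha : a ∈ s
    · exact ⟨1, one_ne_zero, by simpa using Submodule.subset_span ha⟩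
    · obtain ⟨c, hc0, hc⟩ := hmax a ha
      refine ⟨c, hc0, ?_⟩
      simpa [F, Set.image_id] using hc
  choose c hc0 hcF using hc
  obtain ⟨G, hG⟩ := Module.Finite.fg_top (R := T) (M := A)
  let d : T := ∏ g ∈ G, c g
  have hd : d ≠ 0 := Finset.prod_ne_zero_iff.mpr fun g _ ↦ hc0 g
  have hdF : ∀ a : A, d • a ∈ F := by
    have hgen : ∀ g ∈ G, d • g ∈ F := by
      intro g hg
      have : d = (∏ g' ∈ G.erase g, c g') * c g := (Finset.prod_erase_mul G c hg).symm
      rw [this, mul_smul]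
      exact F.smul_mem _ (hcF g)
    intro a
    have ha : a ∈ Submodule.span T (G : Set A) := by rw [hG]; trivial
    induction ha using Submodule.span_induction with
    | mem x hx => exact hgen x hx
    | zero => simp
    | add x y _ _ hx hy => rw [smul_add]; exact F.add_mem hx hy
    | smul r x _ hx => rw [smul_comm]; exact F.smul_mem r hx
  refine ⟨F, hF, LinearMap.codRestrict F (d • LinearMap.id) fun a ↦ hdF a, ?_⟩
  intro a b hab
  have : d • a = d • b := by
    simpa [Subtype.ext_iff] using hab
  exact smul_right_injective A hd this

end Embedding

/-! ### Torsion-freeness of a base change, and contraction of minimal primes -/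

section TorsionFree

/-- If `A` is a finite torsion-free module over a domain `T` and `T → T'` is a flat extension of
domains, then `T' ⊗_T A` is a torsion-free `T'`-module: `A` embeds in a free module `F`, so by
flatness `T' ⊗_T A` embeds in the free `T'`-module `T' ⊗_T F`. [folklore] -/
theorem isTorsionFree_tensorProduct {T : Type*} [CommRing T] [IsDomain T] (T' : Type*)
    [CommRing T'] [Algebra T T'] [Module.Flat T T'] (A : Type*) [AddCommGroup A]
    [Module T A] [Module.IsTorsionFree T A] [Module.Finite T A] :
    Module.IsTorsionFree T' (T' ⊗[T] A) := by
  obtain ⟨F, hF, f, hf⟩ := exists_injective_linearMap_of_isTorsionFree (T := T) (A := A)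
  haveI := hF
  have hinj : Function.Injective (f.baseChange T') := by
    have h := Module.Flat.lTensor_preserves_injective_linearMap (M := T') f hf
    intro x y hxy
    apply h
    have e := LinearMap.baseChange_eq_ltensor (A := T') f
    rw [← e]
    exact hxy
  exact hinj.moduleIsTorsionFree _ fun r m ↦ (f.baseChange T').map_smul r m

/-- A minimal prime of a torsion-free algebra `B` over a domain `T'` contracts to `(0)`: its
elements are zero divisors of `B` (Mathlib `Ideal.exists_mul_mem_of_mem_minimalPrimes`), and a
zero divisor coming from `T'` must vanish by torsion-freeness. [folklore] -/
theorem comap_eq_bot_of_mem_minimalPrimes {T' B : Type*} [CommRing T'] [IsDomain T']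
    [CommRing B] [Algebra T' B] [Module.IsTorsionFree T' B] {Q : Ideal B}
    (hQ : Q ∈ minimalPrimes B) : Q.comap (algebraMap T' B) = ⊥ := by
  refine le_bot_iff.mp fun t ht ↦ ?_
  rw [Ideal.mem_comap] at ht
  obtain ⟨y, hy0, hy⟩ := Ideal.exists_mul_mem_of_mem_minimalPrimes hQ ht
  have hy0' : y ≠ 0 := by simpa using hy0
  have hty : t • y = 0 := by
    rw [Algebra.smul_def]
    simpa using hy
  rcases smul_eq_zero.mp hty with h | h
  · simpa using h
  · exact absurd h hy0'

/-- If `B` is integral over a domain `T'` and torsion-free as a `T'`-module, then for every minimal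
prime `Q` of `B`, `dim B ⧸ Q = dim T'`: `T' → B ⧸ Q` is injective
(`comap_eq_bot_of_mem_minimalPrimes`) and integral, and injective integral extensions preserve the
Krull dimension (Matsumura Thm. 9.4, `Literature.RingTheory.KrullDimension.ringKrullDim_eq_of_isIntegral`). [cite: Matsumura1987, Thm 9.4] -/
theorem ringKrullDim_quotient_eq_of_mem_minimalPrimes (T' : Type*) {B : Type*} [CommRing T']
    [IsDomain T'] [CommRing B] [Algebra T' B] [Module.IsTorsionFree T' B] [Algebra.IsIntegral T' B]
    {Q : Ideal B} (hQ : Q ∈ minimalPrimes B) : ringKrullDim (B ⧸ Q) = ringKrullDim T' := by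
  haveI : Q.IsPrime := hQ.1.1
  have hinj : Function.Injective (algebraMap T' (B ⧸ Q)) := by
    rw [injective_iff_map_eq_zero]
    intro t ht
    rw [IsScalarTower.algebraMap_apply T' B (B ⧸ Q), Ideal.Quotient.algebraMap_eq,
      Ideal.Quotient.eq_zero_iff_mem, ← Ideal.mem_comap, comap_eq_bot_of_mem_minimalPrimes hQ]
      at ht
    simpa using ht
  exact (ringKrullDim_eq_of_isIntegral hinj).symm

end TorsionFree

/-! ### Components of `A ⊗ₖ L` for an affine domain `A` -/

section AffineDomain

/-- Minimal primes are preserved by ring isomorphisms. [folklore] -/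
theorem map_mem_minimalPrimes_of_ringEquiv {R S : Type*} [CommRing R] [CommRing S] (e : R ≃+* S)
    {Q : Ideal R} (hQ : Q ∈ minimalPrimes R) : Q.map e ∈ minimalPrimes S := by
  haveI : Q.IsPrime := hQ.1.1
  rw [← Ideal.height_eq_zero_iff] at hQ ⊢
  rw [RingEquiv.height_map]
  exact hQ

/-- **Components of a base change have the dimension of the variety** (Görtz–Wedhorn I,
Prop. 5.38 with Exercise 5.12; Fulton, *Intersection Theory*, Example 6.2.9: `V_L` is purely
`dim V`-dimensional). For an affine domain `A` over a field `k`, a field extension `L` of `k` and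
a minimal prime `Q` of `A ⊗ₖ L`: `dim (A ⊗ₖ L) ⧸ Q = dim A`. Proof: Noether normalization
`T = k[t₁,…,tₛ] ↪ A` finite; `A ⊗ₖ L ≅ T_L ⊗_T A` with `T_L = L[t₁,…,tₛ]` flat over `T`;
`T_L ⊗_T A` is finite and torsion-free over the domain `T_L`, so its minimal primes contract to
`(0)` and the quotients have dimension `dim T_L = s = dim A`.
[cite: GortzWedhorn2020, Prop. 5.38 and Exercise 5.12] [cite: Fulton1998, Example 6.2.9] -/
theorem ringKrullDim_quotient_tensorProduct_of_mem_minimalPrimes (k L A : Type u) [Field k]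
    [Field L] [Algebra k L] [CommRing A] [IsDomain A] [Algebra k A] [Algebra.FiniteType k A]
    {Q : Ideal (A ⊗[k] L)} (hQ : Q ∈ minimalPrimes (A ⊗[k] L)) :
    ringKrullDim ((A ⊗[k] L) ⧸ Q) = ringKrullDim A := by
  classical
  -- Noether normalization
  obtain ⟨s, g, hg, hfin⟩ := exists_finite_inj_algHom_of_fg k A
  let T := MvPolynomial (Fin s) k
  letI : Algebra T A := g.toRingHom.toAlgebra
  haveI : IsScalarTower k T A := IsScalarTower.of_algebraMap_eq fun x ↦ (g.commutes x).symm
  haveI : Module.Finite T A := hfin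
  have hinjT : Function.Injective (algebraMap T A) := hg
  haveI : Module.IsTorsionFree T A := by
    refine Module.IsTorsionFree.of_smul_eq_zero fun r m h ↦ ?_
    rw [Algebra.smul_def, mul_eq_zero] at h
    rcases h with h | h
    · left
      rw [← map_zero (algebraMap T A)] at h
      exact hinjT h
    · exact Or.inr h
  -- dimension of `A`
  have hdimA : ringKrullDim A = s := by
    haveI : Algebra.IsIntegral T A := inferInstance
    rw [← ringKrullDim_eq_of_isIntegral hinjT, MvPolynomial.ringKrullDim_of_isNoetherianRing,
      ringKrullDim_eq_zero_of_field, Nat.card_eq_fintype_card, Fintype.card_fin, zero_add]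
  -- base change of `T` to `L` (the `T`-algebra structure `MvPolynomial.algebraMvPolynomial` on
  -- `T_L = L[t₁,…,tₛ]` is the one under which Mathlib registers `Algebra.IsPushout k T L T_L`)
  let TL := MvPolynomial (Fin s) L
  letI : Algebra T TL := MvPolynomial.algebraMvPolynomial
  haveI : Module.Flat T TL :=
    Module.Flat.isBaseChange k T L TL (Algebra.IsPushout.out (R := k) (S := T) (R' := L) (S' := TL))
  have hdimTL : ringKrullDim TL = s := by
    rw [MvPolynomial.ringKrullDim_of_isNoetherianRing, ringKrullDim_eq_zero_of_field,
      Nat.card_eq_fintype_card, Fintype.card_fin, zero_add]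
  -- the model `B' = T_L ⊗_T A` of `A ⊗ₖ L`
  let B' := TL ⊗[T] A
  haveI : Module.IsTorsionFree TL B' := isTorsionFree_tensorProduct TL A
  haveI : Algebra.IsIntegral TL B' := inferInstance
  -- `A ⊗ₖ L ≃+* T_L ⊗_T A`
  let e₁ : T ⊗[k] L ≃ₐ[T] TL := Algebra.IsPushout.equiv k T L TL
  let e₂ : TL ⊗[T] A ≃ₐ[T] (T ⊗[k] L) ⊗[T] A := Algebra.TensorProduct.congr e₁.symm AlgEquiv.refl
  let e₃ : (T ⊗[k] L) ⊗[T] A ≃ₐ[T] A ⊗[T] (T ⊗[k] L) := Algebra.TensorProduct.comm T _ _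
  let e₄ : A ⊗[T] (T ⊗[k] L) ≃ₐ[T] A ⊗[k] L := Algebra.TensorProduct.cancelBaseChange k T T A L
  let e : (A ⊗[k] L) ≃+* B' := ((e₂.trans e₃).trans e₄).symm.toRingEquiv
  -- transport the minimal prime
  have hQ' : Q.map e ∈ minimalPrimes B' := map_mem_minimalPrimes_of_ringEquiv e hQ
  have hquot : ringKrullDim ((A ⊗[k] L) ⧸ Q) = ringKrullDim (B' ⧸ Q.map e) :=
    ringKrullDim_eq_of_ringEquiv (Ideal.quotientEquiv Q _ e rfl)
  rw [hquot, ringKrullDim_quotient_eq_of_mem_minimalPrimes TL hQ', hdimTL, hdimA]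

end AffineDomain

/-! ### The relative form: primes of `R ⊗ₖ L` minimal over `𝔭 (R ⊗ₖ L)` -/

section Relative

/-- **Components of the base change of a closed subvariety** (Görtz–Wedhorn I, Exercise 5.12;
Fulton, *Intersection Theory*, Example 6.2.9). Let `R` be of finite type over a field `k`, `L` a
field extension, `R'` a base change of `R` to `L` (`Algebra.IsPushout k R L R'`, e.g.
`R' = R ⊗ₖ L`), and `𝔮 ⊂ R'` a prime which is minimal over `𝔭R'`, where `𝔭 = 𝔮 ∩ R`. Then
`dim R' ⧸ 𝔮 = dim R ⧸ 𝔭`: indeed `R' ⧸ 𝔭R' ≅ (R ⧸ 𝔭) ⊗ₖ L`, and `𝔮 ⧸ 𝔭R'` is a minimal prime of it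
(`ringKrullDim_quotient_tensorProduct_of_mem_minimalPrimes`).
[cite: GortzWedhorn2020, Exercise 5.12] [cite: Fulton1998, Example 6.2.9] -/
theorem ringKrullDim_quotient_eq_of_isPushout_of_mem_minimalPrimes {k L R R' : Type u} [Field k]
    [Field L] [Algebra k L] [CommRing R] [Algebra k R] [Algebra.FiniteType k R] [CommRing R']
    [Algebra k R'] [Algebra R R'] [Algebra L R'] [IsScalarTower k R R'] [IsScalarTower k L R']
    [Algebra.IsPushout k R L R'] (𝔮 : Ideal R') [𝔮.IsPrime]
    (h𝔮 : 𝔮 ∈ ((𝔮.under R).map (algebraMap R R')).minimalPrimes) :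
    ringKrullDim (R' ⧸ 𝔮) = ringKrullDim (R ⧸ 𝔮.under R) := by
  classical
  set 𝔭 : Ideal R := 𝔮.under R with h𝔭def
  set I : Ideal R' := 𝔭.map (algebraMap R R') with hIdef
  have hI𝔮 : I ≤ 𝔮 := Ideal.map_le_iff_le_comap.mpr le_rfl
  -- `R' ≅ R ⊗ₖ L` as `R`-algebras, and `R' ⧸ I ≅ (R ⧸ 𝔭) ⊗ₖ L`
  let e₀ : R ⊗[k] L ≃ₐ[R] R' := Algebra.IsPushout.equiv k R L R'
  have hI : I = (𝔭.map (algebraMap R (R ⊗[k] L))).map (e₀ : R ⊗[k] L →+* R') := by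
    rw [hIdef, Ideal.map_map]
    congr 1
    ext x
    simp
  let e₁ : (R ⊗[k] L) ⧸ 𝔭.map (algebraMap R (R ⊗[k] L)) ≃+* R' ⧸ I :=
    Ideal.quotientEquiv _ _ e₀.toRingEquiv hI
  let e₂ : ((R ⊗[k] L) ⧸ 𝔭.map (algebraMap R (R ⊗[k] L))) ≃ₐ[R ⧸ 𝔭] (R ⧸ 𝔭) ⊗[R] (R ⊗[k] L) :=
    Algebra.TensorProduct.quotIdealMapEquivQuotTensor (R ⊗[k] L) 𝔭
  let e₃ : (R ⧸ 𝔭) ⊗[R] (R ⊗[k] L) ≃ₐ[R ⧸ 𝔭] (R ⧸ 𝔭) ⊗[k] L :=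
    Algebra.TensorProduct.cancelBaseChange k R (R ⧸ 𝔭) (R ⧸ 𝔭) L
  let e : (R' ⧸ I) ≃+* (R ⧸ 𝔭) ⊗[k] L := e₁.symm.trans (e₂.trans e₃).toRingEquiv
  -- the minimal prime `𝔮 ⧸ I` of `R' ⧸ I` and its image `Q`
  have h𝔮I : 𝔮.map (Ideal.Quotient.mk I) ∈ minimalPrimes (R' ⧸ I) := by
    have h := h𝔮
    rw [Ideal.minimalPrimes_eq_comap] at h
    obtain ⟨Q₀, hQ₀, hQ₀𝔮⟩ := h
    have : 𝔮.map (Ideal.Quotient.mk I) = Q₀ := by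
      rw [← hQ₀𝔮, Ideal.map_comap_of_surjective _ Ideal.Quotient.mk_surjective]
    rwa [this]
  have hQ : (𝔮.map (Ideal.Quotient.mk I)).map e ∈ minimalPrimes ((R ⧸ 𝔭) ⊗[k] L) :=
    map_mem_minimalPrimes_of_ringEquiv e h𝔮I
  -- dimensions
  haveI : IsDomain (R ⧸ 𝔭) := Ideal.Quotient.isDomain 𝔭
  have h1 : ringKrullDim (R' ⧸ 𝔮) = ringKrullDim ((R' ⧸ I) ⧸ 𝔮.map (Ideal.Quotient.mk I)) :=
    (ringKrullDim_eq_of_ringEquiv (DoubleQuot.quotQuotEquivQuotOfLE hI𝔮)).symm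
  have h2 : ringKrullDim ((R' ⧸ I) ⧸ 𝔮.map (Ideal.Quotient.mk I)) =
      ringKrullDim (((R ⧸ 𝔭) ⊗[k] L) ⧸ (𝔮.map (Ideal.Quotient.mk I)).map e) :=
    ringKrullDim_eq_of_ringEquiv (Ideal.quotientEquiv _ _ e rfl)
  rw [h1, h2, ringKrullDim_quotient_tensorProduct_of_mem_minimalPrimes k L (R ⧸ 𝔭) hQ]

end Relative

/-! ### Minimality over `𝔭R'` from an Artinian fibre of the localized map -/

section Minimal

open IsLocalRing

/-- Let `φ : R → R'`, `𝔮 ⊂ R'` a prime over `𝔭 = φ⁻¹ 𝔮`, and consider the induced local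
homomorphism `R_𝔭 → R'_𝔮`. If its fibre ring `R'_𝔮 ⧸ 𝔭 R'_𝔮` is Artinian, then `𝔮` is a minimal
prime over `𝔭R'` (a prime ideal `𝔯` is minimal over `I` iff `R_𝔯 ⧸ I R_𝔯` has a single prime
ideal; Görtz–Wedhorn I, proof of Cor. 5.45 (2)). This is how "`z` is a generic point of a
component of the fibre `X'_x`" — finite length of `𝒪_{X', z} ⧸ 𝔪ₓ 𝒪_{X', z}` — is used.
[cite: GortzWedhorn2020, Cor. 5.45 (2) (proof)] -/
theorem mem_minimalPrimes_map_of_isArtinianRing {R R' : Type*} [CommRing R] [CommRing R']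
    (φ : R →+* R') (𝔭 : Ideal R) [𝔭.IsPrime] (𝔮 : Ideal R') [𝔮.IsPrime] (h : 𝔭 = 𝔮.comap φ)
    (hA : IsArtinianRing (Localization.AtPrime 𝔮 ⧸
      (maximalIdeal (Localization.AtPrime 𝔭)).map (Localization.localRingHom 𝔭 𝔮 φ h))) :
    𝔮 ∈ (𝔭.map φ).minimalPrimes := by
  set S := Localization.AtPrime 𝔮 with hSdef
  set J : Ideal S :=
    (maximalIdeal (Localization.AtPrime 𝔭)).map (Localization.localRingHom 𝔭 𝔮 φ h) with hJdef
  -- `J = (𝔭 R') S`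
  have hJ : J = (𝔭.map φ).map (algebraMap R' S) := by
    rw [hJdef, ← Localization.AtPrime.map_eq_maximalIdeal, Ideal.map_map, Ideal.map_map]
    congr 1
    ext x
    exact Localization.localRingHom_to_map 𝔭 𝔮 φ h x
  -- every prime of `S` containing `J` is the maximal ideal
  have hJle : J ≤ maximalIdeal S := by
    rw [hJdef]
    exact Ideal.map_le_iff_le_comap.mpr fun a ha ↦ map_nonunit _ a ha
  have hJtop : J ≠ ⊤ := fun hJ ↦ (maximalIdeal.isMaximal S).ne_top (top_le_iff.mp (hJ ▸ hJle))
  haveI : Nontrivial (S ⧸ J) := Ideal.Quotient.nontrivial_iff.mpr hJtop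
  have key : ∀ P : Ideal S, P.IsPrime → J ≤ P → P = maximalIdeal S := by
    intro P hP hJP
    haveI := hP
    haveI : (P.map (Ideal.Quotient.mk J)).IsPrime :=
      Ideal.map_isPrime_of_surjective Ideal.Quotient.mk_surjective (by rwa [Ideal.mk_ker])
    haveI : (P.map (Ideal.Quotient.mk J)).IsMaximal := IsArtinianRing.isMaximal_of_isPrime _
    have hPmax : (Ideal.comap (Ideal.Quotient.mk J) (P.map (Ideal.Quotient.mk J))).IsMaximal :=
      Ideal.comap_isMaximal_of_surjective _ Ideal.Quotient.mk_surjective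
    rw [Ideal.comap_map_of_surjective _ Ideal.Quotient.mk_surjective,
      ← RingHom.ker_eq_comap_bot, Ideal.mk_ker, sup_eq_left.mpr hJP] at hPmax
    exact IsLocalRing.eq_maximalIdeal hPmax
  -- minimality of `𝔮` over `𝔭 R'`
  refine ⟨⟨inferInstance, Ideal.map_le_iff_le_comap.mpr h.le⟩, ?_⟩
  rintro P ⟨hP, hIP⟩ hP𝔮
  haveI := hP
  have hdisj : Disjoint (𝔮.primeCompl : Set R') P := by
    rw [Set.disjoint_left]
    intro x hx hxP
    exact hx (hP𝔮 hxP)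
  have hP' : (P.map (algebraMap R' S)).IsPrime :=
    IsLocalization.isPrime_of_isPrime_disjoint 𝔮.primeCompl S P hP hdisj
  have hJP' : J ≤ P.map (algebraMap R' S) := by
    rw [hJ]
    exact Ideal.map_mono hIP
  have hPS : P.map (algebraMap R' S) = maximalIdeal S := key _ hP' hJP'
  have : P = 𝔮 := by
    rw [← IsLocalization.under_map_of_isPrime_disjoint 𝔮.primeCompl S hP hdisj, hPS]
    exact Localization.AtPrime.under_maximalIdeal
  exact this.ge

/-- Variant of `mem_minimalPrimes_map_of_isArtinianRing` with the hypothesis stated as finiteness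
of the length of the fibre ring as a module over itself (the multiplicity appearing in flat
pull-back of cycles, Fulton, *Intersection Theory*, §1.7). [cite: GortzWedhorn2020, Cor. 5.45 (2) (proof)] -/
theorem mem_minimalPrimes_map_of_length_ne_top {R R' : Type*} [CommRing R] [CommRing R']
    (φ : R →+* R') (𝔭 : Ideal R) [𝔭.IsPrime] (𝔮 : Ideal R') [𝔮.IsPrime] (h : 𝔭 = 𝔮.comap φ)
    (hlen : Module.length
      (Localization.AtPrime 𝔮 ⧸
        (maximalIdeal (Localization.AtPrime 𝔭)).map (Localization.localRingHom 𝔭 𝔮 φ h))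
      (Localization.AtPrime 𝔮 ⧸
        (maximalIdeal (Localization.AtPrime 𝔭)).map (Localization.localRingHom 𝔭 𝔮 φ h)) ≠ ⊤) :
    𝔮 ∈ (𝔭.map φ).minimalPrimes := by
  refine mem_minimalPrimes_map_of_isArtinianRing φ 𝔭 𝔮 h ?_
  rw [Module.length_ne_top_iff] at hlen
  exact ((isFiniteLength_iff_isNoetherian_isArtinian).mp hlen).2

end Minimal

end Literature.RingTheory.KrullDimension

end
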